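/-
Origin: expansion seat `planner-pub-hodgecm-mc-sanity-1-g15-0`, handover #SAN30AR 2026-08-21T03:36Z md5 44727ac670ef (SAN-30AR; NEW additive KERNEL census leaf, 101 l., 2 theorems ∕ 0 Prop-defs in ns HodgeCM.Model.Sanity — the degenerate census of the hR end-state E term «AR» `perL_picardCM_r21AEOGIAR` (RUN 70, #EAR): `perL_r21AEOGIAR_degS_scope` («AR» over `S := degS`, `W := zeroSK ∘ W` closes PerL modulo its own `C` = SAN-30's `CdegSOGS` at the kernel `hA`, unwrapped; the eight Prop rows discharged at every context, guards ignored; no `hR` line), `CdegSOGS_hAR_elim` (that `C` is SAN-30A's EMPTY type — from it anything follows: no degenerate datum closes «AR»); imports Model.E2InstanceOGR21AEPIAR + Sanity.DegenerateClosureOGIA only; no rowdep in RUN 71; drop-alone; TABLED IFF «AR» green at `RUN 70 (` AND E DET₇₀ words «AR», else DROP; rc 0 ∕ 0 warn ∕ 0 proof holes ∕ closures ⊆ trio 2 ∕ 2; NAME LIST: HodgeCM.Model.Sanity.perL_r21AEOGIAR_degS_scope · HodgeCM.Model.Sanity.CdegSOGS_hAR_elim) (`HOME/mc/pub-hodgecm-mc-sanity-1-g15/stage71/HodgeCM/Model/Sanity/DegenerateClosureOGIAR.lean`,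 md5 44727ac670ef, 101 lines);
landed by the gen-30 packager (p-g30) in gate run 71 as `HodgeCM/Model/Sanity/DegenerateClosureOGIAR.lean` (verbatim).
-/
/-
HodgeCM / MODEL-CONSTRUCTION sub-cell (pub-hodgecm), SANITY lane (unit `pub-hodgecm-mc-sanity-1-g14`, node SAN-30AR).
NEW additive KERNEL leaf `HodgeCM/Model/Sanity/DegenerateClosureOGIAR.lean`; imports the hR END-STATE E TERM
`HodgeCM.Model.E2InstanceOGR21AEPIAR` (glue-1 #EAR, RUN 70; lead 1-g84 WORD (α-AR) STATUS l.14985 (3)) and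
SAN-30A `HodgeCM.Model.Sanity.DegenerateClosureOGIA` (RUN 69); nothing imports it; 0 records, 0 `def … : Prop`, 0 hypotheses records,
0 proof holes; MODEL-N ±0; E bytes untouched.
-/
import Summits.HodgeConjecture.HodgeCM.Model.E2InstanceOGR21AEPIAR
import Summits.HodgeConjecture.HodgeCM.Model.Sanity.DegenerateClosureOGIA

/-!
# SAN-30AR — the degenerate census of the hR END-STATE E TERM «AR» (RUN 70): «A» with its cited row `hR` DISCHARGED IN THE KERNEL

«AR» `Model.perL_picardCM_r21AEOGIAR` (glue-1 #EAR) is the E term of record «A» `Model.perL_picardCM_r21AEOGIA` (RUN 68) applied once at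
`hR := Literature.AlgebraicGeometry.HodgeTheory.deligneMilne1982_Thm_6_20_full_holds` (packet hR, RUN 69): 12 binder groups
`W S μ hΘ C hT hpd hk gen12 real34 hyp12 hyp34` (CONSTRUCT 4 ∕ PROVE 8 ∕ CITE 0), every `S`/`W`-parametric row byte-identical to «A»'s.
Hence its census over the degenerate data `S := degS`, `W := zeroSK ∘ W` is SAN-30A's with the `hR` line gone:

* `perL_r21AEOGIAR_degS_scope (C : CdegSOGS … arapura2012_cor_15_4_6_holds W μ) : PerL` — «AR» over the degenerate data
  closes PerL modulo EXACTLY its own group `C` (SAN-30's scope-guarded oriented data binder at the kernel `hA`), handed over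
  unwrapped; the eight Prop rows `hΘ hT hpd hk gen12 real34 hyp12 hyp34` discharged at every context, guards ignored, by the
  SAN-22/25/27/30 discharges verbatim;
* `CdegSOGS_hAR_elim` — «AR»'s group `C` is byte-for-byte «A»'s (it never mentioned `hR`), i.e. SAN-30A's EMPTY type
  (`isEmpty_CdegSOGS_orientBitι_hA`): from a closing datum `C` over the degenerate data ANY proposition follows — no degenerate
  datum closes «AR».

READING (census): striking the cited row `hR` by its kernel proof changes no `S`/`W`-parametric byte of E; the gatekeeper `C` against a
degenerate closing is byte-for-byte E₅₆'s (SAN-27/28/30/30A), uninhabited over `degS` — «AR» is closed by NO degenerate data.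
KERNEL ONLY: 2 theorems; nothing here is a claim of the manuscripts under adjudication.
-/

set_option autoImplicit false

noncomputable section

namespace HodgeCM
namespace Model
namespace Sanity

open HodgeCM.Universe (SideData ThetaModel AdelicThetaCore AdelicTorusCore)
open HodgeCM.PerL34 HodgeCM.PerL34.ArchC
open Literature.AlgebraicGeometry.HodgeTheory Literature.NumberTheory.Automorphic.PicardCM
open Literature.NumberTheory.Transcendental (Arapura2012_Cor_15_4_6 arapura2012_cor_15_4_6_holds)
open Literature.AlgebraicGeometry.ShimuraVarieties
open Literature.AlgebraicGeometry.Motives (CMType)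
open HodgeCM.Model.ThetaSpace
open HodgeCM.Model.SupplyResidual

variable (hHD : exists_isReal_hodgeModel) (hI : hodgePQ_independent_of_hodgeModel)
  (h₁ : BallQuotientUniformised)

/-- **The hR end-state child «AR» over the degenerate data closes PerL modulo EXACTLY its own (scope-guarded) group `C`**,
handed over unwrapped — the other eight Prop rows discharged at every context, guards ignored (SAN-22/25/27/30 verbatim);
no `hR` line: «AR» carries none. -/
theorem perL_r21AEOGIAR_degS_scope (h₃' : CMAbelianVarietyEigenbasisRealised)
    (W : ∀ {L : CMField} {ι₁ : L →+* ℂ} (V : HermSpace3 L ι₁) (c : SeesawCtx L), WmInput V c.D)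
    (μ : ∀ {L : CMField}, SeesawCtx L → Fin 4 → NumberField.InfinitePlace L → ℤ)
    (C : CdegSOGS hHD hI h₁ (cmAbelianVarietyRealised_of_eigenbasis hHD hI h₃') orientBitι arapura2012_cor_15_4_6_holds W μ) :
    (picardCMUniverse hHD hI h₁ (cmAbelianVarietyRealised_of_eigenbasis hHD hI h₃')).PerL := by
  refine perL_picardCM_r21AEOGIAR hHD hI h₁ h₃' (fun V c => (W V c).zeroSK) degS μ
    ?_ C ?_ ?_ ?_ ?_ ?_ ?_ ?_
  · -- `hΘ` at the bit of record, guards ignored — SAN-22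
    intro L ι₁ V c _ _ _ i
    exact hTheta_degS hHD hI h₁ _ (orientBitι L ι₁) (embOf hHD hI h₁ _) (coverOf hHD hI h₁ _ arapura2012_cor_15_4_6_holds)
      (wmOfInput fun V c => (W V c).zeroSK) (d12Of μ) (d34Of μ) V c i
  · -- `hT`
    intro L ι₁ V c k N
    exact isThetaArchContinuous_degS V c k N
  · -- `hpd` — vacuous over the empty `C`-fibre
    intro L ι₁ V c hV hc h6 hcan k hk N hN
    exact ((isEmpty_C_fibre_degS hHD hI h₁ _ V c hV).false (C V c hV hc h6 hcan)).elim
  · -- `hk` (along form)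
    intro L ι₁ V c hV hc h6 hcan k hk N hN p
    exact ((isEmpty_C_fibre_degS hHD hI h₁ _ V c hV).false (C V c hV hc h6 hcan)).elim
  · -- `gen12`, scope read through its rank component
    intro L ι₁ V c hc h6 _
    exact gen12_degS' hHD hI h₁ _ (orientBitι L ι₁) (embOf hHD hI h₁ _) (coverOf hHD hI h₁ _ arapura2012_cor_15_4_6_holds)
      (fun V c => (W V c).zeroSK) μ V c hc h6.1
  · -- `real34`, guards ignored
    intro L ι₁ V c _ _ _
    exact real34_zeroSK (embOf hHD hI h₁ _) (coverOf hHD hI h₁ _ arapura2012_cor_15_4_6_holds) W _ (orientBitι L ι₁)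
      (d12Of μ) (d34Of μ) V c
  · -- `hyp12`, guards ignored
    intro L ι₁ V c _ _ _
    exact hyp12_zeroSK (embOf hHD hI h₁ _) (coverOf hHD hI h₁ _ arapura2012_cor_15_4_6_holds) W _ (orientBitι L ι₁) _ _ _ V c
  · -- `hyp34`, guards ignored
    intro L ι₁ V c _ _ _
    exact hyp34_zeroSK (embOf hHD hI h₁ _) (coverOf hHD hI h₁ _ arapura2012_cor_15_4_6_holds) W _ (orientBitι L ι₁) _ _ _ V c

/-- **No degenerate datum closes «AR»** — its hand-over premise `C` is SAN-30A's empty type: from it ANY proposition follows. -/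
theorem CdegSOGS_hAR_elim (h₃' : CMAbelianVarietyEigenbasisRealised)
    (W : ∀ {L : CMField} {ι₁ : L →+* ℂ} (V : HermSpace3 L ι₁) (c : SeesawCtx L), WmInput V c.D)
    (μ : ∀ {L : CMField}, SeesawCtx L → Fin 4 → NumberField.InfinitePlace L → ℤ) (P : Prop)
    (C : CdegSOGS hHD hI h₁ (cmAbelianVarietyRealised_of_eigenbasis hHD hI h₃') orientBitι arapura2012_cor_15_4_6_holds W μ) : P :=
  CdegSOGS_hA_elim hHD hI h₁ (cmAbelianVarietyRealised_of_eigenbasis hHD hI h₃') W μ P C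

end Sanity
end Model
end HodgeCM

end
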